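import Mathlib
import Summits.ValiantsHypothesis.ValiantsHypothesis.Theorems.FifoMatchingNNDivisionHardBinomialPowers
import Summits.ValiantsHypothesis.ValiantsHypothesis.Theorems.FifoMatchingNNDivisionHardSplitFace
import Summits.ValiantsHypothesis.ValiantsHypothesis.Theorems.FifoMatchingNNMonotoneExpBound
import HarnessLib

/-!
# Route FifoMatching — crux `NNDivisionHard` (stmt-ValiantsHypothesis-21181): EVERY SINGLE-ARC-AVOIDING FACE `NN_n^{¬{e}}`
# IS HARD; binomial powers `(a·x^P + b·x^Q)^D` are not certificates, UNCONDITIONALLY in `P ≠ Q`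

`…BinomialPowers.lean` proved the face `NN_n^{¬{e}}` (nest-free perfect matchings avoiding the arc variable `e`) hard for
SHORT `e` (`(j − i)³ ≤ n²`, long-arc thick-queue measure).  A LONG arc `e = (i, j)` (`j ≥ i + 2`) CROSSES an even boundary
`2b` (`i < 2b ≤ j`), and no block-stable matching uses a crossing arc, so the split face of `…SplitFace.lean` survives inside
the `e`-avoiding family: `top_{𝟙_L}(NN_{b+c}^{¬{e}}) = top_{𝟙_L}(NN_{b+c}) = ι_L(NN_b) · ι_R(NN_c)`, whence
`L₊(NN_b), L₊(NN_c) ≤ L₊(NN^{¬{e}}) + 3` with `max (b, c) ≥ n/2`.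

* `topComponent_lWeight_arcAvoidingFace` — the split face of the `e`-avoiding family for a crossing arc `e`;
* `complexity_nn_left_le_arcAvoidingFace`, `complexity_nn_right_le_arcAvoidingFace` — `L₊(NN_b) ≤ L₊(NN_{b+c}^{¬{e}}) + 3`,
  `L₊(NN_c) ≤ L₊(NN_{b+c}^{¬{e}}) + 3`;
* ★★ `crossingArcFace_exp_lower_bound` — eventually in `n`: `2^{⌈n/2⌉^{1/6}} ≤ L₊(NN_n^{¬{e}}) + 3` for every arc variable
  `e = (i, j)` with `j ≥ i + 2` (via `NNMonotoneExpBound.exp_lower_bound` at half size);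
* ★★ `arcFace_qp_hard` — **for every `c`, eventually in `n`: for EVERY arc variable `e` and every `L` with
  `L₊(NN_n^{¬{e}}) ≤ 16 ((2n+1) (L + 2))²` one has `2^((log₂ n + c)^c) < L`** (short arcs: `…BinomialPowers`; long arcs: the
  crossing route);
* `exists_opener_ne_of_ne` — two distinct perfect matchings differ at an opener of the second;
* ★★ `binomialPow_not_certificate_qp'` — **for every `c`, eventually in `n`: for every nest-free perfect matching `P`, every
  perfect matching `Q ≠ P`, `a ≠ 0`, `b`, and EVERY `D`, `h = (a·x^P + b·x^Q)^D` satisfies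
  `2^((log₂ n + c)^c) < L₊(NN_n · h) + L₊(h)`.**

HONEST FRAMING: closes the binomial-power family for ONE candidate; stmt-21181 stays OPEN; nothing here bears on `NNNotVP`
or on VP ≠ VNP (NOT proved).  No definitions, no named facts.
References: Hrubeš–Yehudayoff 2021 §6 Problem 2 [HrubesYehudayoff2021]; Chen–Deng–Du–Stanley–Yan 2007 §1
[ChenDengDuStanleyYan2007]; Bürgisser 2000 Rem. 2.7 [Burgisser2000].
-/

noncomputable section

-- Sub = Summit single-conjunct layout: the duplicated namespace component is mandated by the tree.
set_option linter.dupNamespace false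
set_option autoImplicit false

namespace Summit.ValiantsHypothesis.ValiantsHypothesis.Theorems.FifoMatching.NNDivisionHard.ArcFaces

open Finset MvPolynomial Literature.Computability.AlgebraicComplexity
open Summit.ValiantsHypothesis.ValiantsHypothesis.Theorems.ZeroOneTransfer.Negative (topComponent)
open Summit.ValiantsHypothesis.ValiantsHypothesis.Theorems.FifoMatching.NNDivisionHard.StackPowersQueue
  (blockEmb blockEmb_injective topComponent_sum_arcMonomial shiftMatching shiftMatching_mem)
open Summit.ValiantsHypothesis.ValiantsHypothesis.Theorems.FifoMatching.NNDivisionHard.LinearTransport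
  (complexity_le_of_vars_outside)
open Summit.ValiantsHypothesis.ValiantsHypothesis.Theorems.FifoMatching.NNDivisionHard.SplitFace
  (lWeight blockEmbR two_mul_le blockEmbR_injective topComponent_lWeight weight_le weight_eq_iff glue2 glue2_mem
    glue2_stable support_rename_blockEmbR_outside support_rename_blockEmb_outside)
open Summit.ValiantsHypothesis.ValiantsHypothesis.Theorems.FifoMatching.NNDivisionHard.ArcElimination
  (complexity_arcAvoidingFace_le_of_binomialPow)
open Summit.ValiantsHypothesis.ValiantsHypothesis.Theorems.FifoMatching.NNDivisionHard.BinomialPowers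
  (shortArcFace_exp_lower_bound absorb_arith absorb_exp)
open scoped NNReal BigOperators

/-! ### §1 The split face inside a crossing-arc-avoiding family -/

section Split

variable {b c : ℕ}

/-- **Split face of the `e`-avoiding family for a CROSSING arc** `e` (`e.1 < 2b ≤ e.2`):
`top_{𝟙_L}(NN_{b+c}^{¬{e}}) = ι_L(NN_b) · ι_R(NN_c)` — block-stable matchings use no crossing arc.
[cite: ChenDengDuStanleyYan2007, §1] -/
theorem topComponent_lWeight_arcAvoidingFace (e : Fin (2 * (b + c)) × Fin (2 * (b + c)))
    (he1 : (e.1 : ℕ) < 2 * b) (he2 : 2 * b ≤ (e.2 : ℕ)) :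
    topComponent (lWeight b c) (∑ M ∈ (nestFreeMatchings (2 * (b + c))).filter
        (fun M => ∀ j ∈ openers M, (j, M j) ∉ ({e} : Finset (Fin (2 * (b + c)) × Fin (2 * (b + c))))),
        arcMonomial ℝ≥0 M) =
      rename (blockEmb (two_mul_le b c)) (nestFreeMatchingPoly b ℝ≥0) *
        rename (blockEmbR b c) (nestFreeMatchingPoly c ℝ≥0) := by
  classical
  set S := (nestFreeMatchings (2 * (b + c))).filter
    (fun M => ∀ j ∈ openers M, (j, M j) ∉ ({e} : Finset (Fin (2 * (b + c)) × Fin (2 * (b + c))))) with hS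
  have hSsub : S ⊆ perfectMatchings (2 * (b + c)) :=
    (Finset.filter_subset _ _).trans nestFreeMatchings_subset_perfectMatchings
  -- a block-stable matching avoids the crossing arc `e`
  have hstable_avoids : ∀ M : Fin (2 * (b + c)) → Fin (2 * (b + c)),
      (∀ i : Fin (2 * (b + c)), (i : ℕ) < 2 * b → (M i : ℕ) < 2 * b) →
      ∀ j ∈ openers M, (j, M j) ∉ ({e} : Finset (Fin (2 * (b + c)) × Fin (2 * (b + c)))) := by
    intro M hst j _ hje
    rw [Finset.mem_singleton, Prod.ext_iff] at hje
    obtain ⟨h1, h2⟩ := hje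
    simp only at h1 h2
    have hj : (j : ℕ) < 2 * b := by rw [h1]; exact he1
    have := hst j hj
    rw [h2] at this
    omega
  have hG := glue2_mem (shiftMatching_mem b) (shiftMatching_mem c)
  have hGS : glue2 (shiftMatching b) (shiftMatching c) ∈ S :=
    Finset.mem_filter.2 ⟨hG, hstable_avoids _ (glue2_stable _ _)⟩
  have h1 : topComponent (lWeight b c) (∑ M ∈ S, arcMonomial ℝ≥0 M) =
      ∑ M ∈ S.filter (fun M => Finsupp.weight (lWeight b c) (arcExponent M) = b), arcMonomial ℝ≥0 M :=
    topComponent_sum_arcMonomial (lWeight b c) hSsub (W := b) (fun M hM => weight_le (hSsub hM))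
      ⟨_, hGS, (weight_eq_iff (nestFreeMatchings_subset_perfectMatchings hG)).2 (glue2_stable _ _)⟩
  have h2 : topComponent (lWeight b c) (nestFreeMatchingPoly (b + c) ℝ≥0) =
      ∑ M ∈ (nestFreeMatchings (2 * (b + c))).filter (fun M => Finsupp.weight (lWeight b c) (arcExponent M) = b),
        arcMonomial ℝ≥0 M := by
    rw [nestFreeMatchingPoly_eq_sum_arcMonomial]
    exact topComponent_sum_arcMonomial (lWeight b c) nestFreeMatchings_subset_perfectMatchings (W := b)
      (fun M hM => weight_le (nestFreeMatchings_subset_perfectMatchings hM))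
      ⟨_, hG, (weight_eq_iff (nestFreeMatchings_subset_perfectMatchings hG)).2 (glue2_stable _ _)⟩
  have h3 : S.filter (fun M => Finsupp.weight (lWeight b c) (arcExponent M) = b) =
      (nestFreeMatchings (2 * (b + c))).filter (fun M => Finsupp.weight (lWeight b c) (arcExponent M) = b) := by
    ext M
    simp only [hS, Finset.mem_filter]
    constructor
    · rintro ⟨⟨hM, -⟩, hW⟩; exact ⟨hM, hW⟩
    · rintro ⟨hM, hW⟩
      exact ⟨⟨hM, hstable_avoids M ((weight_eq_iff (nestFreeMatchings_subset_perfectMatchings hM)).1 hW)⟩, hW⟩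
  rw [h1, h3, ← h2, topComponent_lWeight]

/-- `L₊(NN_b) ≤ L₊(NN_{b+c}^{¬{e}}) + 3` for a crossing arc `e`. [cite: Burgisser2000, Rem. 2.7] -/
theorem complexity_nn_left_le_arcAvoidingFace (e : Fin (2 * (b + c)) × Fin (2 * (b + c)))
    (he1 : (e.1 : ℕ) < 2 * b) (he2 : 2 * b ≤ (e.2 : ℕ)) :
    complexity (nestFreeMatchingPoly b ℝ≥0) ≤ complexity (∑ M ∈ (nestFreeMatchings (2 * (b + c))).filter
        (fun M => ∀ j ∈ openers M, (j, M j) ∉ ({e} : Finset (Fin (2 * (b + c)) × Fin (2 * (b + c))))),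
        arcMonomial ℝ≥0 M) + 3 := by
  have hR0 : rename (blockEmbR b c) (nestFreeMatchingPoly c ℝ≥0) ≠ 0 := fun h0 =>
    MonomialCofactor.nn_ne_zero c (rename_injective _ blockEmbR_injective (by rw [h0, map_zero]))
  have H := complexity_le_of_vars_outside (blockEmb_injective (two_mul_le b c)) (lWeight b c)
    (topComponent_lWeight_arcAvoidingFace e he1 he2) hR0 (support_rename_blockEmbR_outside _)
    (h := (1 : MvPolynomial (Fin (2 * (b + c)) × Fin (2 * (b + c))) ℝ≥0)) one_ne_zero
    (fun v hv => by simp [vars_one] at hv)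
  rw [mul_one] at H
  omega

/-- `L₊(NN_c) ≤ L₊(NN_{b+c}^{¬{e}}) + 3` for a crossing arc `e`. [cite: Burgisser2000, Rem. 2.7] -/
theorem complexity_nn_right_le_arcAvoidingFace (e : Fin (2 * (b + c)) × Fin (2 * (b + c)))
    (he1 : (e.1 : ℕ) < 2 * b) (he2 : 2 * b ≤ (e.2 : ℕ)) :
    complexity (nestFreeMatchingPoly c ℝ≥0) ≤ complexity (∑ M ∈ (nestFreeMatchings (2 * (b + c))).filter
        (fun M => ∀ j ∈ openers M, (j, M j) ∉ ({e} : Finset (Fin (2 * (b + c)) × Fin (2 * (b + c))))),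
        arcMonomial ℝ≥0 M) + 3 := by
  have hL0 : rename (blockEmb (two_mul_le b c)) (nestFreeMatchingPoly b ℝ≥0) ≠ 0 := fun h0 =>
    MonomialCofactor.nn_ne_zero b (rename_injective _ (blockEmb_injective (two_mul_le b c)) (by rw [h0, map_zero]))
  have H := complexity_le_of_vars_outside blockEmbR_injective (lWeight b c)
    ((topComponent_lWeight_arcAvoidingFace e he1 he2).trans (mul_comm _ _)) hL0 (support_rename_blockEmb_outside _)
    (h := (1 : MvPolynomial (Fin (2 * (b + c)) × Fin (2 * (b + c))) ℝ≥0)) one_ne_zero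
    (fun v hv => by simp [vars_one] at hv)
  rw [mul_one] at H
  omega

end Split

/-! ### §2 Every arc face is hard -/

variable {n : ℕ}

/-- ★★ **CROSSING (LONG) ARCS.**  Eventually in `n`: for every arc variable `e = (i, j)` with `i + 2 ≤ j` there is a half
`m` (`n ≤ 2m`) with `2^{m^{1/6}} ≤ L₊(NN_n^{¬{e}}) + 3`. [cite: HrubesYehudayoff2021, §6 Problem 2] -/
theorem crossingArcFace_exp_lower_bound : ∃ n₀ : ℕ, ∀ n : ℕ, n₀ ≤ n → ∀ e : Fin (2 * n) × Fin (2 * n),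
    (e.1 : ℕ) + 2 ≤ (e.2 : ℕ) → ∃ m : ℕ, n ≤ 2 * m ∧
      (2 : ℝ) ^ ((m : ℝ) ^ ((1 : ℝ) / 6)) ≤
        ((complexity (∑ M ∈ (nestFreeMatchings (2 * n)).filter (fun M => ∀ j ∈ openers M, (j, M j) ∉ ({e} :
          Finset (Fin (2 * n) × Fin (2 * n)))), arcMonomial ℝ≥0 M) + 3 : ℕ) : ℝ) := by
  obtain ⟨n₀, hn₀⟩ := NNMonotoneExpBound.exp_lower_bound
  refine ⟨2 * n₀, fun n hn e he => ?_⟩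
  -- the boundary `2b` with `e.1 < 2b ≤ e.2`
  obtain ⟨b, hb⟩ : ∃ b : ℕ, b = (e.1 : ℕ) / 2 + 1 := ⟨_, rfl⟩
  have hb1 : (e.1 : ℕ) < 2 * b := by omega
  have hb2 : 2 * b ≤ (e.2 : ℕ) := by omega
  have hbn : b ≤ n := by have := e.2.isLt; omega
  obtain ⟨c, hc⟩ := Nat.exists_eq_add_of_le hbn
  subst hc
  by_cases hbc : c ≤ b
  · refine ⟨b, by omega, ?_⟩
    have h1 := hn₀ b (by omega)
    have h2 := complexity_nn_left_le_arcAvoidingFace e hb1 hb2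
    exact h1.trans (by exact_mod_cast h2)
  · refine ⟨c, by omega, ?_⟩
    have h1 := hn₀ c (by omega)
    have h2 := complexity_nn_right_le_arcAvoidingFace e hb1 hb2
    exact h1.trans (by exact_mod_cast h2)

/-- Eventually `(log₂ n + K)^K < m^{1/6}` for every half `m` of `n`. [folklore] -/
theorem polylog_lt_rpow_half_eventually (K : ℕ) : ∃ n₀ : ℕ, ∀ n : ℕ, n₀ ≤ n → ∀ m : ℕ, n ≤ 2 * m →
    (((Nat.log 2 n + K) ^ K : ℕ) : ℝ) < (m : ℝ) ^ ((1 : ℝ) / 6) := by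
  obtain ⟨n₂, hn₂⟩ := CorSandwich.polylog_lt_rpow_eventually (K + 1) (c := 1 / 6) (by norm_num)
  refine ⟨2 * n₂ + 2, fun n hn m hm => ?_⟩
  have hm2 : n₂ ≤ m := by omega
  have hm1 : 1 ≤ m := by omega
  have h := hn₂ m hm2
  -- `log₂ n ≤ log₂ m + 1`
  have hlog : Nat.log 2 n ≤ Nat.log 2 m + 1 := by
    have : Nat.log 2 n ≤ Nat.log 2 (2 * m) := Nat.log_mono_right hm
    rw [show 2 * m = m * 2 by ring, Nat.log_mul_base one_lt_two (by omega)] at this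
    exact this
  have hle : (Nat.log 2 n + K) ^ K ≤ (Nat.log 2 m + (K + 1)) ^ (K + 1) :=
    calc (Nat.log 2 n + K) ^ K ≤ (Nat.log 2 m + (K + 1)) ^ K := Nat.pow_le_pow_left (by omega) K
      _ ≤ (Nat.log 2 m + (K + 1)) ^ (K + 1) := Nat.pow_le_pow_right (by omega) (by omega)
  exact lt_of_le_of_lt (by exact_mod_cast hle) h

/-- ★★ **EVERY ARC FACE IS HARD (quasi-polynomial currency).**  For every `c`, eventually in `n`: for every arc variable `e`
and every `L`, `L₊(NN_n^{¬{e}}) ≤ 16 ((2n+1) (L + 2))² ⇒ 2^((log₂ n + c)^c) < L`. [cite: HrubesYehudayoff2021, §6 Problem 2] -/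
theorem arcFace_qp_hard (c : ℕ) : ∃ n₀ : ℕ, ∀ n : ℕ, n₀ ≤ n → ∀ e : Fin (2 * n) × Fin (2 * n), ∀ L : ℕ,
    complexity (∑ M ∈ (nestFreeMatchings (2 * n)).filter (fun M => ∀ j ∈ openers M, (j, M j) ∉ ({e} :
      Finset (Fin (2 * n) × Fin (2 * n)))), arcMonomial ℝ≥0 M) ≤ 16 * ((2 * n + 1) * (L + 2)) ^ 2 →
    2 ^ ((Nat.log 2 n + c) ^ c) < L := by
  set K : ℕ := c + 14 with hK
  obtain ⟨n₁, hn₁⟩ := shortArcFace_exp_lower_bound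
  obtain ⟨n₂, hn₂⟩ := crossingArcFace_exp_lower_bound
  obtain ⟨n₃, hn₃⟩ := polylog_lt_rpow_half_eventually (K + 2)
  refine ⟨max (max n₁ n₂) (max n₃ 1), fun n hn e L hface => ?_⟩
  have hn1 : n₁ ≤ n := le_trans (le_trans (le_max_left _ _) (le_max_left _ _)) hn
  have hn2 : n₂ ≤ n := le_trans (le_trans (le_max_right _ _) (le_max_left _ _)) hn
  have hn3 : n₃ ≤ n := le_trans (le_trans (le_max_left _ _) (le_max_right _ _)) hn
  have hn1' : 1 ≤ n := le_trans (le_trans (le_max_right _ _) (le_max_right _ _)) hn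
  set F := complexity (∑ M ∈ (nestFreeMatchings (2 * n)).filter (fun M => ∀ j ∈ openers M, (j, M j) ∉ ({e} :
      Finset (Fin (2 * n) × Fin (2 * n)))), arcMonomial ℝ≥0 M) with hF
  by_contra hle
  push Not at hle
  -- absorption: `16((2n+1)(L+2))² + 3 ≤ 2^((ℓ + K + 2)^(K + 2))`
  have e1 := absorb_arith n c L hle
  have e3 : 2 ^ (2 * (Nat.log 2 n + c) ^ c + 2 * Nat.log 2 n + 13) ≤ 2 ^ ((Nat.log 2 n + K) ^ K) :=
    Nat.pow_le_pow_right (by norm_num) (absorb_exp (Nat.log 2 n) c)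
  have h7 : 16 * ((2 * n + 1) * (L + 2)) ^ 2 + 1 ≤ 2 ^ ((Nat.log 2 n + K) ^ K) := e1.trans e3
  have hp : (Nat.log 2 n + K) ^ K + 2 ≤ (Nat.log 2 n + (K + 2)) ^ (K + 2) := by
    have h1 : (Nat.log 2 n + K) ^ K ≤ (Nat.log 2 n + (K + 2)) ^ K := Nat.pow_le_pow_left (by omega) K
    have h2 : 1 ≤ (Nat.log 2 n + (K + 2)) ^ K := Nat.one_le_pow _ _ (by omega)
    have h3 : 2 ^ 2 ≤ (Nat.log 2 n + (K + 2)) ^ 2 := Nat.pow_le_pow_left (by omega) 2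
    have h4 : 3 * (Nat.log 2 n + (K + 2)) ^ K ≤ (Nat.log 2 n + (K + 2)) ^ K * (Nat.log 2 n + (K + 2)) ^ 2 := by
      rw [mul_comm]
      exact Nat.mul_le_mul_left _ (by norm_num at h3; omega)
    calc (Nat.log 2 n + K) ^ K + 2 ≤ 3 * (Nat.log 2 n + (K + 2)) ^ K := by omega
      _ ≤ (Nat.log 2 n + (K + 2)) ^ K * (Nat.log 2 n + (K + 2)) ^ 2 := h4
      _ = (Nat.log 2 n + (K + 2)) ^ (K + 2) := by rw [← pow_add]
  have h8 : 16 * ((2 * n + 1) * (L + 2)) ^ 2 + 3 ≤ 2 ^ ((Nat.log 2 n + (K + 2)) ^ (K + 2)) := by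
    calc 16 * ((2 * n + 1) * (L + 2)) ^ 2 + 3 ≤ 4 * (16 * ((2 * n + 1) * (L + 2)) ^ 2 + 1) := by omega
      _ ≤ 4 * 2 ^ ((Nat.log 2 n + K) ^ K) := Nat.mul_le_mul_left 4 h7
      _ = 2 ^ ((Nat.log 2 n + K) ^ K + 2) := by rw [pow_add]; ring
      _ ≤ 2 ^ ((Nat.log 2 n + (K + 2)) ^ (K + 2)) := Nat.pow_le_pow_right (by norm_num) hp
  -- a half `m` with `2^{m^{1/6}} ≤ F + 3`, for every arc
  have hmain : ∃ m : ℕ, n ≤ 2 * m ∧ (2 : ℝ) ^ ((m : ℝ) ^ ((1 : ℝ) / 6)) ≤ ((F + 3 : ℕ) : ℝ) := by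
    by_cases hlong : (e.1 : ℕ) + 2 ≤ (e.2 : ℕ)
    · by_cases hcube : ((e.2 : ℕ) - (e.1 : ℕ)) ^ 3 ≤ n ^ 2
      · refine ⟨n, by omega, (hn₁ n hn1 e hcube).trans ?_⟩
        exact_mod_cast Nat.add_le_add_left (by norm_num : 1 ≤ 3) F
      · exact hn₂ n hn2 e hlong
    · have hcube : ((e.2 : ℕ) - (e.1 : ℕ)) ^ 3 ≤ n ^ 2 := by
        have h1 : (e.2 : ℕ) - (e.1 : ℕ) ≤ 1 := by omega
        have h1' : ((e.2 : ℕ) - (e.1 : ℕ)) ^ 3 ≤ 1 ^ 3 := Nat.pow_le_pow_left h1 3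
        have hn1'' : 1 ≤ n ^ 2 := Nat.one_le_pow _ _ (by omega)
        omega
      refine ⟨n, by omega, (hn₁ n hn1 e hcube).trans ?_⟩
      exact_mod_cast Nat.add_le_add_left (by norm_num : 1 ≤ 3) F
  obtain ⟨m, hm, hexp⟩ := hmain
  have h2 := hn₃ n hn3 m hm
  have h3 : (2 : ℝ) ^ ((((Nat.log 2 n + (K + 2)) ^ (K + 2) : ℕ) : ℝ)) < (2 : ℝ) ^ ((m : ℝ) ^ ((1 : ℝ) / 6)) :=
    Real.rpow_lt_rpow_of_exponent_lt (by norm_num) h2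
  have h4 : ((2 ^ ((Nat.log 2 n + (K + 2)) ^ (K + 2)) : ℕ) : ℝ) < ((F + 3 : ℕ) : ℝ) := by
    rw [Nat.cast_pow, Nat.cast_ofNat, ← Real.rpow_natCast]
    exact h3.trans_le hexp
  have h5 : 2 ^ ((Nat.log 2 n + (K + 2)) ^ (K + 2)) < F + 3 := by exact_mod_cast h4
  -- contradiction: `2^((ℓ+K+2)^(K+2)) < F + 3 ≤ 16((2n+1)(L+2))² + 3 ≤ 2^((ℓ+K+2)^(K+2))`
  have h9 : F + 3 ≤ 16 * ((2 * n + 1) * (L + 2)) ^ 2 + 3 := Nat.add_le_add_right hface 3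
  exact absurd (lt_of_lt_of_le h5 (h9.trans h8)) (lt_irrefl _)

/-! ### §3 Binomial powers, unconditionally -/

/-- Two distinct perfect matchings differ at an opener of the second. [folklore] -/
theorem exists_opener_ne_of_ne {P Q : Fin (2 * n) → Fin (2 * n)} (hP : P ∈ perfectMatchings (2 * n))
    (hQ : Q ∈ perfectMatchings (2 * n)) (hne : P ≠ Q) : ∃ i : Fin (2 * n), i < Q i ∧ P i ≠ Q i := by
  by_contra hall
  push Not at hall
  obtain ⟨hPinv, -⟩ := mem_perfectMatchings.1 hP
  obtain ⟨hQinv, hQfp⟩ := mem_perfectMatchings.1 hQ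
  apply hne
  funext i
  rcases lt_or_gt_of_ne (hQfp i).symm with hlt | hgt
  · exact hall i hlt
  · -- `i` is a closer of `Q`: `Q i < i`, and `Q i` is an opener with partner `i`
    have hop : Q i < Q (Q i) := by rw [hQinv]; exact hgt
    have h1 := hall (Q i) hop
    rw [hQinv] at h1
    -- `P (Q i) = i`, hence `P i = Q i`
    have := congrArg P h1
    rw [hPinv] at this
    exact this.symm

/-- ★★ **BINOMIAL POWERS ARE NOT CERTIFICATES — unconditionally in `P ≠ Q`.**  For every `c`, eventually in `n`: for
every nest-free perfect matching `P`, perfect matching `Q ≠ P`, `a ≠ 0`, `b`, and EVERY `D`, the cofactor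
`h = (a·x^P + b·x^Q)^D` satisfies `2^((log₂ n + c)^c) < L₊(NN_n · h) + L₊(h)`. [cite: HrubesYehudayoff2021, §6 Problem 2] -/
theorem binomialPow_not_certificate_qp' (c : ℕ) : ∃ n₀ : ℕ, ∀ n : ℕ, n₀ ≤ n → ∀ P Q : Fin (2 * n) → Fin (2 * n),
    P ∈ nestFreeMatchings (2 * n) → Q ∈ perfectMatchings (2 * n) → P ≠ Q → ∀ a b : ℝ≥0, a ≠ 0 → ∀ D : ℕ,
      2 ^ ((Nat.log 2 n + c) ^ c) <
        complexity (nestFreeMatchingPoly n ℝ≥0 * (C a * arcMonomial ℝ≥0 P + C b * arcMonomial ℝ≥0 Q) ^ D) +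
          complexity ((C a * arcMonomial ℝ≥0 P + C b * arcMonomial ℝ≥0 Q) ^ D) := by
  obtain ⟨n₀, hn₀⟩ := arcFace_qp_hard c
  refine ⟨n₀, fun n hn P Q hP hQ hne a b ha D => ?_⟩
  obtain ⟨i, hi, hPQ⟩ := exists_opener_ne_of_ne (nestFreeMatchings_subset_perfectMatchings hP) hQ hne
  have hface := complexity_arcAvoidingFace_le_of_binomialPow hP hQ hi hPQ ha b D
  exact lt_of_lt_of_le (hn₀ n hn (i, Q i) _ hface) (Nat.le_add_right _ _)

end Summit.ValiantsHypothesis.ValiantsHypothesis.Theorems.FifoMatching.NNDivisionHard.ArcFaces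

end
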